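import Summits.QuantumFields.QCD.Theses.NestedDissectionSea

/-!
Planner scratch file — crux-ideate round 1, ideator 2, crux `SeaFactorisationBridge`
(stmt-QuantumFields-13880). Each `def … : Prop` is the FIRST checkable statement of one idea card;
nothing is proved here (they only have to elaborate).

* `SchurOfHermitianAddITau`, `TwistedSplittingBound` — card `twisted-elliptic-splitting`.
* `SlabGapTransfer` — card `superconfinement-carry`.
* `SeparatorSheetMarkov` — card `impedance-coordinates`.
-/

set_option autoImplicit false

namespace Summit.QuantumFields.QCD.Cruxes.SeaFactorisationBridge.SketchIdeator2

open scoped BigOperators Matrix ComplexConjugate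
open MeasureTheory Finset
open Literature.MathematicalPhysics.QuantumLattice Literature.MathematicalPhysics.QuantumFieldTheory
  Literature.Probability.LatticeModels

/-- First lemma of card `twisted-elliptic-splitting` (abstract linear algebra, provable now):
**every Schur complement of `H + iτ` (`H` Hermitian, `τ > 0`) is uniformly elliptic with constant `τ`.**
Writing `M = H + iτ·1` and `S = M_qq − M_qp (M_pp)⁻¹ M_pq` for a predicate `p` (`q = ¬p`), one has
`Im ⟨v, S v⟩ ≥ τ ‖v‖²` for every `v`, hence `σ_min(S) ≥ τ` and `‖S⁻¹‖ ≤ 1/τ`. Proof sketch: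
`(M_pp)⁻¹ = (H_pp − iτ)(H_pp² + τ²)⁻¹`, so `S = A + iτ B` with `A` Hermitian and
`B = 1 + H_qp (H_pp² + τ²)⁻¹ H_pq ≥ 1`. Applied to `H = Γ₅ · wilsonCell U μ x s` (Hermitian by
`wilsonDirac_gammaFive_hermitian_holds` restricted to a site set, the ingredient of `DirichletDetReal`)
it says: EVERY separator of the twisted Wilson hierarchy, at EVERY dissection level and for EVERY gauge
field, has `σ_min ≥ τ` — the twisted sea has no resonant cells. -/
def SchurOfHermitianAddITau : Prop :=
  ∀ (n : Type) [Fintype n] [DecidableEq n] (H : Matrix n n ℂ), H.IsHermitian →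
    ∀ τ : ℝ, 0 < τ → ∀ (p : n → Prop) [DecidablePred p],
      let M : Matrix n n ℂ := H + ((τ : ℂ) * Complex.I) • (1 : Matrix n n ℂ)
      let S : Matrix {a // ¬ p a} {a // ¬ p a} ℂ :=
        M.toBlock (fun a => ¬ p a) (fun a => ¬ p a) -
          M.toBlock (fun a => ¬ p a) p * (M.toBlock p p)⁻¹ * M.toBlock p (fun a => ¬ p a)
      ∀ v : {a // ¬ p a} → ℂ, τ * ∑ a, ‖v a‖ ^ 2 ≤ (∑ a, star (v a) * S.mulVec v a).im

/-- First lemma of card `twisted-elliptic-splitting` (tree level, provable now): **the twisted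
splitting is a suppression.** With `Q = Γ₅ D_W(U, m, 1)` (Hermitian Wilson operator,
`Γ₅ = spinorLift gammaFive`) and any twist `τ > 0`: `det Q` is real, the twisted-doublet weight
`det((Q + iτ)(Q − iτ)) = det(Q² + τ²)` is real and strictly positive on EVERY configuration (this is the
catalogued evasion `WilsonDeterminantMassSplitting.det_twisted_pos`), and
`|det D_W(U,m,1)|² ≤ det(Q² + τ²)`: the exact factor `F_τ(U) := det D_W / det(Q²+τ²)^{1/2} =
∏_j q_j/√(q_j²+τ²)` lies in `[-1, 1]`, is real-analytic in `U`, and carries the sign `(-1)^{n₋}` and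
all near-zero modes; the bosonic flow only ever sees `det(Q²+τ²)^{N_f/2}`. -/
def TwistedSplittingBound : Prop :=
  ∀ (L : ℕ) [NeZero L] (U : GaugeConfig 4 L ↥(Matrix.specialUnitaryGroup (Fin 3) ℂ)) (m τ : ℝ),
    0 < τ →
      let Q := spinorLift (L := L) (N := 3) gammaFive * wilsonDirac (fundamentalRep (Fin 3)) U m 1
      let Iτ := ((τ : ℂ) * Complex.I) • (1 : Matrix _ _ ℂ)
      Q.det.im = 0 ∧ ((Q + Iτ) * (Q - Iτ)).det.im = 0 ∧ 0 < ((Q + Iτ) * (Q - Iτ)).det.re ∧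
        ‖fermionDet (wilsonDirac (fundamentalRep (Fin 3)) U m 1)‖ ^ 2 ≤ ((Q + Iτ) * (Q - Iτ)).det.re

/-- First lemma of card `superconfinement-carry` (the load-bearing statistical-mechanics transfer,
stated over the D1 vocabulary; NOT provable now — it is the line's first real target): **a quasi-local
block perturbation that is sup-small at a block scale many correlation lengths long preserves uniform
slab decoupling.** Hypothesis on the REFERENCE (pure Wilson measure at `β` on the odd torus
`(ℤ/(2S+1))⁴`, i.e. `W = 0`): for every axis `i` and all bounded measurable `F`, `G` depending only on
links based in two slabs `{x_i ∈ [0,w)}`, `{x_i ∈ [w+t, w+t+w')}` with both cyclic gaps `≥ t`,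
`|⟨FG⟩ − ⟨F⟩⟨G⟩| ≤ e^{−Δt} ‖F‖_{L²} ‖G‖_{L²}` (the transfer-matrix form of a uniform lattice gap `Δ`
in lattice units, in all four directions — what `RobustYangMills` at `W ≡ 0` plus reflection
positivity / axis symmetry of Wilson's action deliver). Conclusion: there are `ε₀ > 0`, `n₀`, `C`
depending only on `κ` such that for block size `b` with `Δ b ≥ n₀` and every perturbation `W` with
`‖W‖_{b,κ} ≤ ε₀`, the perturbed measure `μ_{β,W}` decouples time slabs at rate `Δ/2` with constant `C`,
uniformly in the volume `S` and in `β`. -/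
def SlabGapTransfer : Prop :=
  let G := ↥(Matrix.specialUnitaryGroup (Fin 3) ℂ)
  let ρ : G →* Matrix (Fin 3) (Fin 3) ℂ := fundamentalRep (Fin 3)
  ∀ κ : ℝ, 0 < κ → ∀ Δ : ℝ, 0 < Δ → ∃ ε₀ : ℝ, 0 < ε₀ ∧ ∃ n₀ : ℝ, ∃ C : ℝ, 0 < C ∧
    ∀ (S b : ℕ) (β : ℝ) (W : QuasiLocalGaugePerturbation 4 (2 * S + 1) G b),
      n₀ ≤ Δ * b → W.NormLE κ ε₀ →
      let T : ℕ := 2 * S + 1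
      let slab : Fin 4 → ℕ → ℕ → Set (Edge 4 T) := fun i t₀ w =>
        {e | ((e.1 i) - (t₀ : ZMod T)).val < w}
      (∀ (i : Fin 4) (w t w' : ℕ) (F G' : GaugeConfig 4 T G → ℝ), w + t + w' + t ≤ T →
        Measurable F → Measurable G' → (∃ c, ∀ U, |F U| ≤ c) → (∃ c, ∀ U, |G' U| ≤ c) →
        DependsOn F (slab i 0 w) → DependsOn G' (slab i (w + t) w') →
        |(0 : QuasiLocalGaugePerturbation 4 T G b).expectation ρ β (fun U => F U * G' U) -
            (0 : QuasiLocalGaugePerturbation 4 T G b).expectation ρ β F *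
              (0 : QuasiLocalGaugePerturbation 4 T G b).expectation ρ β G'| ≤
          Real.exp (-(Δ * t)) *
            Real.sqrt ((0 : QuasiLocalGaugePerturbation 4 T G b).expectation ρ β (fun U => F U ^ 2)) *
            Real.sqrt ((0 : QuasiLocalGaugePerturbation 4 T G b).expectation ρ β (fun U => G' U ^ 2))) →
      ∀ (w t w' : ℕ) (F G' : GaugeConfig 4 T G → ℝ) (cF cG : ℝ), w + t + w' + t ≤ T →
        Measurable F → Measurable G' → (∀ U, |F U| ≤ cF) → (∀ U, |G' U| ≤ cG) →
        DependsOn F (slab 0 0 w) → DependsOn G' (slab 0 (w + t) w') →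
        |W.expectation ρ β (fun U => F U * G' U) - W.expectation ρ β F * W.expectation ρ β G'| ≤
          C * Real.exp (-(Δ / 2 * t)) * cF * cG

/-- First lemma of card `impedance-coordinates` (provable now, size M): **the separator sees the
children only through their boundary Green matrices and the sheet-touching links** (hierarchical
Poincaré–Steklov / nested-dissection Markov property). If two gauge fields agree on every link with an
endpoint on the internal separator `Σ` of the corner-`0` box of sides `s`, and the inverses of their
children blocks agree on the pairs of interior points adjacent to `Σ`, then their Schur separator
matrices coincide. Ingredients: `wilsonDirac_apply_eq_zero_of_far` (nearest-neighbour support, so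
`D_ΣI` has non-zero columns only at `Σ`-adjacent interior points and `D_ΣΣ`, `D_ΣI`, `D_IΣ` read only
sheet-touching links). -/
def SeparatorSheetMarkov : Prop :=
  ∀ (N : ℕ) [NeZero N] (U U' : GaugeConfig 4 N ↥(Matrix.specialUnitaryGroup (Fin 3) ℂ)) (μ : ℝ)
    (s : Fin 4 → ℕ),
    let sep : TorusSite 4 N → Prop := fun y =>
      siteBox 0 s y ∧ ¬ ∃ ε : Fin 4 → Bool, siteBox (halfCorner s ε) (halfSides s ε) y
    let adj : TorusSite 4 N → TorusSite 4 N → Prop := fun y z =>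
      ∃ i : Fin 4, z = Literature.MathematicalPhysics.QuantumFieldTheory.Site.shift y i ∨ y = Literature.MathematicalPhysics.QuantumFieldTheory.Site.shift z i
    (∀ e : Edge 4 N, (sep e.1 ∨ sep (Literature.MathematicalPhysics.QuantumFieldTheory.Site.shift e.1 e.2)) → U e = U' e) →
    (∀ q q' : {p // childrenInterior (N := N) s p},
        (∃ y, sep y ∧ adj y q.1.1.1) → (∃ y, sep y ∧ adj y q'.1.1.1) →
          (childrenBlock U μ s)⁻¹ q q' = (childrenBlock U' μ s)⁻¹ q q') →
    schurSeparator U μ s = schurSeparator U' μ s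

/-! ### Proof of `SchurOfHermitianAddITau` (card `twisted-elliptic-splitting`, first lemma) -/

section Proofs

variable {n : Type} [Fintype n]

/-- The quadratic form of a Hermitian matrix is real. -/
theorem im_sum_star_mul_mulVec_hermitian (H : Matrix n n ℂ) (hH : H.IsHermitian) (w : n → ℂ) :
    (∑ a, star (w a) * (H.mulVec w) a).im = 0 := by
  have hz : star w ⬝ᵥ (H *ᵥ w) = ∑ a, star (w a) * (H.mulVec w) a := rfl
  have hconj : star (star w ⬝ᵥ (H *ᵥ w)) = star w ⬝ᵥ (H *ᵥ w) := by
    calc star (star w ⬝ᵥ (H *ᵥ w)) = star (H *ᵥ w) ⬝ᵥ w := by rw [Matrix.star_dotProduct, star_star]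
      _ = (star w ᵥ* Hᴴ) ⬝ᵥ w := by rw [Matrix.star_mulVec]
      _ = (star w ᵥ* H) ⬝ᵥ w := by rw [hH.eq]
      _ = star w ⬝ᵥ (H *ᵥ w) := by rw [Matrix.dotProduct_mulVec]
  rw [← hz]
  exact Complex.conj_eq_iff_im.1 hconj

/-- `Im ⟨w, (H + iτ) w⟩ = τ ‖w‖²` for Hermitian `H`. -/
theorem im_quadForm_hermitian_add [DecidableEq n] (H : Matrix n n ℂ) (hH : H.IsHermitian) (τ : ℝ) (w : n → ℂ) :
    (∑ a, star (w a) * ((H + ((τ : ℂ) * Complex.I) • (1 : Matrix n n ℂ)).mulVec w) a).im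
      = τ * ∑ a, ‖w a‖ ^ 2 := by
  have hsplit : ∀ a, star (w a) * ((H + ((τ : ℂ) * Complex.I) • (1 : Matrix n n ℂ)).mulVec w) a
      = star (w a) * (H.mulVec w) a + ((τ : ℂ) * Complex.I) * (star (w a) * w a) := by
    intro a
    rw [Matrix.add_mulVec, Matrix.smul_mulVec, Matrix.one_mulVec]
    simp only [Pi.add_apply, Pi.smul_apply, smul_eq_mul]
    ring
  simp_rw [hsplit, Finset.sum_add_distrib, Complex.add_im]
  rw [im_sum_star_mul_mulVec_hermitian H hH w, zero_add, ← Finset.mul_sum, Complex.mul_im]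
  have hre : (∑ a, star (w a) * w a).im = 0 := by
    rw [Complex.im_sum]
    refine Finset.sum_eq_zero fun a _ => ?_
    rw [Complex.star_def, Complex.conj_mul']
    norm_cast
  have hre' : (∑ a, star (w a) * w a).re = ∑ a, ‖w a‖ ^ 2 := by
    rw [Complex.re_sum]
    refine Finset.sum_congr rfl fun a _ => ?_
    rw [Complex.star_def, Complex.conj_mul']
    norm_cast
  rw [hre, hre']
  simp

/-- Invertibility of `H_pp + iτ` on a sub-block (it is again "Hermitian + iτ"). -/
theorem isUnit_toBlock_hermitian_add [DecidableEq n] (H : Matrix n n ℂ) (hH : H.IsHermitian) (τ : ℝ) (hτ : 0 < τ)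
    (p : n → Prop) [DecidablePred p] :
    IsUnit ((H + ((τ : ℂ) * Complex.I) • (1 : Matrix n n ℂ)).toBlock p p) := by
  set M : Matrix n n ℂ := H + ((τ : ℂ) * Complex.I) • (1 : Matrix n n ℂ) with hM
  have hblock : M.toBlock p p = H.toBlock p p + ((τ : ℂ) * Complex.I) • (1 : Matrix _ _ ℂ) := by
    ext i j
    simp only [hM, Matrix.toBlock_apply, Matrix.add_apply, Matrix.smul_apply]
    by_cases hij : i = j
    · subst hij; simp
    · have : (i : n) ≠ (j : n) := fun h => hij (Subtype.ext h)
      simp [hij, this]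
  have hHerm : (H.toBlock p p).IsHermitian := hH.submatrix _
  rw [← Matrix.mulVec_injective_iff_isUnit]
  intro y₁ y₂ hy
  have key : ∀ y : {a // p a} → ℂ, (M.toBlock p p).mulVec y = 0 → y = 0 := by
    intro y hy0
    have him := im_quadForm_hermitian_add (H.toBlock p p) hHerm τ y
    rw [← hblock, hy0] at him
    simp only [Pi.zero_apply, mul_zero, Finset.sum_const_zero, Complex.zero_im] at him
    have hsum : ∑ a, ‖y a‖ ^ 2 = 0 := by
      have := him.symm
      rcases mul_eq_zero.1 this with h | h
      · exact absurd h hτ.ne'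
      · exact h
    funext a
    have := (Finset.sum_eq_zero_iff_of_nonneg (fun b _ => by positivity)).1 hsum a (Finset.mem_univ a)
    simpa using this
  have : (M.toBlock p p).mulVec (y₁ - y₂) = 0 := by rw [Matrix.mulVec_sub, hy, sub_self]
  exact sub_eq_zero.1 (key _ this)

/-- **Every Schur complement of `H + iτ` is `τ`-elliptic.** -/
theorem schurOfHermitianAddITau_holds [DecidableEq n] (H : Matrix n n ℂ) (hH : H.IsHermitian) (τ : ℝ) (hτ : 0 < τ)
    (p : n → Prop) [DecidablePred p] (v : {a // ¬ p a} → ℂ) :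
    let M : Matrix n n ℂ := H + ((τ : ℂ) * Complex.I) • (1 : Matrix n n ℂ)
    let S : Matrix {a // ¬ p a} {a // ¬ p a} ℂ :=
      M.toBlock (fun a => ¬ p a) (fun a => ¬ p a) -
        M.toBlock (fun a => ¬ p a) p * (M.toBlock p p)⁻¹ * M.toBlock p (fun a => ¬ p a)
    τ * ∑ a, ‖v a‖ ^ 2 ≤ (∑ a, star (v a) * S.mulVec v a).im := by
  intro M S
  -- the harmonic extension of `v` into the `p`-block
  set y : {a // p a} → ℂ := - ((M.toBlock p p)⁻¹).mulVec ((M.toBlock p (fun a => ¬ p a)).mulVec v)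
    with hy
  set w : n → ℂ := fun a => if h : p a then y ⟨a, h⟩ else v ⟨a, h⟩ with hw
  have hunit : IsUnit (M.toBlock p p) := isUnit_toBlock_hermitian_add H hH τ hτ p
  have hdet : IsUnit (M.toBlock p p).det := (Matrix.isUnit_iff_isUnit_det _).1 hunit
  -- block formula for `M *ᵥ w`
  have hMw : ∀ a : n, M.mulVec w a =
      ∑ b : {b // p b}, M a b * y b + ∑ b : {b // ¬ p b}, M a b * v b := by
    intro a
    simp only [Matrix.mulVec, dotProduct]
    rw [← Fintype.sum_subtype_add_sum_subtype p (fun b => M a b * w b)]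
    congr 1
    · refine Finset.sum_congr rfl fun b _ => ?_
      simp [hw, b.2]
    · refine Finset.sum_congr rfl fun b _ => ?_
      simp [hw, b.2]
  -- on the `p`-block: `M *ᵥ w = 0`
  have hp : ∀ a : {a // p a}, M.mulVec w a = 0 := by
    intro a
    rw [hMw]
    have h1 : ∑ b : {b // p b}, M a b * y b = ((M.toBlock p p).mulVec y) a := by
      simp [Matrix.mulVec, dotProduct, Matrix.toBlock_apply]
    have h2 : ∑ b : {b // ¬ p b}, M a b * v b = ((M.toBlock p (fun a => ¬ p a)).mulVec v) a := by
      simp [Matrix.mulVec, dotProduct, Matrix.toBlock_apply]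
    rw [h1, h2, hy, Matrix.mulVec_neg, Matrix.mulVec_mulVec, Matrix.mul_nonsing_inv _ hdet,
      Matrix.one_mulVec]
    simp
  -- on the `¬p`-block: `M *ᵥ w = S *ᵥ v`
  have hq : ∀ a : {a // ¬ p a}, M.mulVec w a = S.mulVec v a := by
    intro a
    rw [hMw]
    have h1 : ∑ b : {b // p b}, M a b * y b = ((M.toBlock (fun a => ¬ p a) p).mulVec y) a := by
      simp [Matrix.mulVec, dotProduct, Matrix.toBlock_apply]
    have h2 : ∑ b : {b // ¬ p b}, M a b * v b =
        ((M.toBlock (fun a => ¬ p a) (fun a => ¬ p a)).mulVec v) a := by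
      simp [Matrix.mulVec, dotProduct, Matrix.toBlock_apply]
    rw [h1, h2, hy]
    simp only [S, Matrix.sub_mulVec, Matrix.mulVec_neg, Matrix.mulVec_mulVec, Pi.sub_apply,
      Pi.neg_apply, Matrix.mul_assoc]
    ring
  -- assemble: ⟨w, M w⟩ = ⟨v, S v⟩
  have hform : ∑ a, star (w a) * M.mulVec w a = ∑ a, star (v a) * S.mulVec v a := by
    rw [← Fintype.sum_subtype_add_sum_subtype p (fun a => star (w a) * M.mulVec w a)]
    have hzero : ∑ a : {a // p a}, star (w a) * M.mulVec w a = 0 :=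
      Finset.sum_eq_zero fun a _ => by rw [hp a, mul_zero]
    rw [hzero, zero_add]
    refine Finset.sum_congr rfl fun a _ => ?_
    rw [hq a]
    simp [hw, a.2]
  have him := im_quadForm_hermitian_add H hH τ w
  rw [hform] at him
  rw [him]
  -- τ Σ_{¬p} ‖v‖² ≤ τ Σ_n ‖w‖²
  have hle : ∑ a : {a // ¬ p a}, ‖v a‖ ^ 2 ≤ ∑ a, ‖w a‖ ^ 2 := by
    rw [← Fintype.sum_subtype_add_sum_subtype p (fun a => ‖w a‖ ^ 2)]
    have h1 : ∑ a : {a // ¬ p a}, ‖w a‖ ^ 2 = ∑ a : {a // ¬ p a}, ‖v a‖ ^ 2 :=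
      Finset.sum_congr rfl fun a _ => by simp [hw, a.2]
    rw [h1]
    have h0 : 0 ≤ ∑ a : {a // p a}, ‖w a‖ ^ 2 := Finset.sum_nonneg fun a _ => by positivity
    linarith
  exact mul_le_mul_of_nonneg_left hle hτ.le


/-- The first lemma of card `twisted-elliptic-splitting` HOLDS (std axioms). -/
theorem schurOfHermitianAddITau : SchurOfHermitianAddITau :=
  fun _ _ _ H hH τ hτ p _ v => schurOfHermitianAddITau_holds H hH τ hτ p v

end Proofs

end Summit.QuantumFields.QCD.Cruxes.SeaFactorisationBridge.SketchIdeator2
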